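import Summits.QuantumFields.YangMills.Theorems.VirialFluxGapPeriodicSoftnessWindowArithmeticZero
import Mathlib
import HarnessLib

/-!
# LINE «sharp-sigma» on crux ⟨stmt-QuantumFields-24197⟩ `SwapVirialDeficit.SwapGluedStiffness` (planner ym-idea-4 g14, skeleton
# `bc/g14-B/sigma/SwapGluedStiffness_sharp_birth.lean`): the stub `stub_windowArithmeticSigma` BY NAME

The pure window arithmetic of the line: on Laplace windows `L ≤ β^{a'}` with `a' = min (a/2) (θ/(2(q+4)))` the thresholds of the
σ-glued convexity transport hold eventually in `β`: `β > 0`, `β₀ ≤ β/2`, `L ≤ x^a` and `x^{−θ} ≤ (β/2)^{−θ}` for `x ≥ β/2`,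
`K L^q (β/2)^{−θ} ≤ 18L⁴ − 2`, and `8√(K L^q (β/2)^{−θ}(18L⁴−2)) ≤ 1/4` (the product is `≤ 36K β^{−θ/2} ≤ 1/1024` once
`β ≥ (36864K)^{2/θ}`).  The Prop `WindowArithmeticSigma` is restated CHARACTER-IDENTICALLY from the skeleton (namespace of this file).

Mathlib + tree only; no `sorry`; standard axioms.  HONEST LABEL: an S/M helper of a DRAFT-by-design second line; the heart `stub_sharpSwapLaplace`,
the crux 24197, the route and every summit statement are untouched; the Yang–Mills mass gap is NOT proved.  Width seat `ym-line-sfw-p2-w3`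
g36 (cell ym-idea-1, free hands), `--supports stmt-QuantumFields-24197`.
-/

set_option autoImplicit false

noncomputable section

namespace Summit.QuantumFields.YangMills.Theorems.SwapVirialDeficitSwapGluedStiffnessWindow

open Summit.QuantumFields.YangMills.Theorems.VirialFluxGapPeriodicSoftnessWindow (le_rpow_of_rpow_inv_le)

/-- Statement of `stub_windowArithmeticSigma` (pure asymptotics on Laplace windows) — verbatim from the skeleton
`SwapGluedStiffness_sharp_birth.lean` (LINE «sharp-sigma», ym-idea-4 g14). [problem-side definition] -/
def WindowArithmeticSigma : Prop :=
  ∀ a K q θ β₀ : ℝ, 0 < a → 0 < K → 0 ≤ q → 0 < θ → θ ≤ 1 → ∃ a' : ℝ, 0 < a' ∧ ∃ β₁ : ℝ, ∀ β : ℝ, β₁ ≤ β →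
    ∀ L : ℕ, 1 ≤ L → (L : ℝ) ≤ β ^ a' →
      0 < β ∧ β₀ ≤ β / 2 ∧
      (∀ x : ℝ, β / 2 ≤ x → (L : ℝ) ≤ x ^ a ∧ x ^ (-θ) ≤ (β / 2) ^ (-θ)) ∧
      K * (L : ℝ) ^ q * (β / 2) ^ (-θ) ≤ 18 * (L : ℝ) ^ 4 - 2 ∧
      8 * Real.sqrt (K * (L : ℝ) ^ q * (β / 2) ^ (-θ) * (18 * (L : ℝ) ^ 4 - 2)) ≤ 1 / 4

/-- ★ **`stub_windowArithmeticSigma` BY NAME**: the window arithmetic of LINE «sharp-sigma» holds with `a' = min (a/2) (θ/(2(q+4)))`.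
[folklore] -/
theorem stub_windowArithmeticSigma : WindowArithmeticSigma := by
  intro a K q θ β₀ ha hK hq hθ hθ1
  obtain ⟨a', ha'0, ha'a, ha'q⟩ : ∃ a' : ℝ, 0 < a' ∧ a' ≤ a / 2 ∧ a' * (q + 4) ≤ θ / 2 := by
    refine ⟨min (a / 2) (θ / (2 * (q + 4))), lt_min (by positivity) (by positivity), min_le_left _ _, ?_⟩
    calc min (a / 2) (θ / (2 * (q + 4))) * (q + 4) ≤ θ / (2 * (q + 4)) * (q + 4) :=
          mul_le_mul_of_nonneg_right (min_le_right _ _) (by positivity)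
      _ = θ / 2 := by field_simp
  set C₄ : ℝ := 36864 * K with hC₄
  have hC₄0 : 0 ≤ C₄ := by positivity
  have hθ2 : 0 < θ / 2 := by positivity
  refine ⟨a', ha'0, max 4 (max (2 * β₀) (C₄ ^ (1 / (θ / 2)))), ?_⟩
  intro β hβ L hL hLβ
  have hβ4 : 4 ≤ β := le_trans (le_max_left _ _) hβ
  have hββ₀ : 2 * β₀ ≤ β := le_trans ((le_max_left _ _).trans (le_max_right _ _)) hβ
  have hβC₄ : C₄ ^ (1 / (θ / 2)) ≤ β := le_trans ((le_max_right _ _).trans (le_max_right _ _)) hβ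
  have hβ1 : 1 ≤ β := by linarith only [hβ4]
  have hβ0 : 0 < β := by linarith only [hβ4]
  have hh0 : 0 < β / 2 := by positivity
  have hh1 : 1 ≤ β / 2 := by linarith only [hβ4]
  have hℓ1 : (1 : ℝ) ≤ L := by exact_mod_cast hL
  have hℓ0 : (0 : ℝ) < L := by linarith only [hℓ1]
  have hP1 : 1 ≤ (L : ℝ) ^ 4 := one_le_pow₀ hℓ1
  have hR0 : 0 ≤ (L : ℝ) ^ q := Real.rpow_nonneg hℓ0.le _
  -- `β^{θ/2} ≥ C₄`
  have hG : C₄ ≤ β ^ (θ / 2) := le_rpow_of_rpow_inv_le hC₄0 hθ2 hβC₄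
  have hG0 : 0 < β ^ (θ / 2) := Real.rpow_pos_of_pos hβ0 _
  -- `(β/2)^{−θ} ≤ 2 β^{−θ}`
  have hhalf : (β / 2) ^ (-θ) ≤ 2 * β ^ (-θ) := by
    rw [Real.div_rpow hβ0.le (by norm_num), Real.rpow_neg (by norm_num : (0 : ℝ) ≤ 2), div_eq_mul_inv, inv_inv, mul_comm]
    refine mul_le_mul_of_nonneg_right ?_ (Real.rpow_nonneg hβ0.le _)
    have : (2 : ℝ) ^ θ ≤ 2 ^ (1 : ℝ) := Real.rpow_le_rpow_of_exponent_le (by norm_num) hθ1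
    rwa [Real.rpow_one] at this
  have hhalf0 : 0 ≤ (β / 2) ^ (-θ) := Real.rpow_nonneg hh0.le _
  -- `L^{q+4} ≤ β^{θ/2}` and the product bound `X ≤ 36 K β^{−θ/2} ≤ 1/1024`
  have hq4 : (L : ℝ) ^ q * (L : ℝ) ^ 4 ≤ β ^ (θ / 2) := by
    have e : (L : ℝ) ^ q * (L : ℝ) ^ 4 = (L : ℝ) ^ (q + 4) := by
      rw [Real.rpow_add hℓ0, show (4 : ℝ) = ((4 : ℕ) : ℝ) by norm_num, Real.rpow_natCast]
    rw [e]
    calc (L : ℝ) ^ (q + 4) ≤ (β ^ a') ^ (q + 4) := Real.rpow_le_rpow hℓ0.le hLβ (by linarith only [hq])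
      _ = β ^ (a' * (q + 4)) := by rw [← Real.rpow_mul hβ0.le]
      _ ≤ β ^ (θ / 2) := Real.rpow_le_rpow_of_exponent_le hβ1 ha'q
  have hprod : β ^ (θ / 2) * β ^ (-θ) = (β ^ (θ / 2))⁻¹ := by
    rw [← Real.rpow_add hβ0, ← Real.rpow_neg hβ0.le]; ring_nf
  have hX : K * (L : ℝ) ^ q * (β / 2) ^ (-θ) * (18 * (L : ℝ) ^ 4 - 2) ≤ 36 * K * (β ^ (θ / 2))⁻¹ := by
    have h1 : K * (L : ℝ) ^ q * (β / 2) ^ (-θ) * (18 * (L : ℝ) ^ 4 - 2) ≤ K * (L : ℝ) ^ q * (β / 2) ^ (-θ) * (18 * (L : ℝ) ^ 4) :=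
      mul_le_mul_of_nonneg_left (by linarith only [hP1]) (by positivity)
    have h2 : K * (L : ℝ) ^ q * (β / 2) ^ (-θ) * (18 * (L : ℝ) ^ 4) = 18 * K * ((L : ℝ) ^ q * (L : ℝ) ^ 4) * (β / 2) ^ (-θ) := by ring
    have h3 : 18 * K * ((L : ℝ) ^ q * (L : ℝ) ^ 4) * (β / 2) ^ (-θ) ≤ 18 * K * β ^ (θ / 2) * (2 * β ^ (-θ)) :=
      mul_le_mul (mul_le_mul_of_nonneg_left hq4 (by positivity)) hhalf hhalf0 (by positivity)
    have h4 : 18 * K * β ^ (θ / 2) * (2 * β ^ (-θ)) = 36 * K * (β ^ (θ / 2) * β ^ (-θ)) := by ring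
    rw [hprod] at h4
    linarith only [h1, h2.le, h2.ge, h3, h4.le, h4.ge]
  have hinvC : 36 * K * (β ^ (θ / 2))⁻¹ ≤ 1 / 1024 := by
    have h1 : (β ^ (θ / 2))⁻¹ ≤ C₄⁻¹ := inv_anti₀ (by positivity) hG
    have h2 : 36 * K * C₄⁻¹ = 1 / 1024 := by rw [hC₄]; field_simp; norm_num
    linarith only [mul_le_mul_of_nonneg_left h1 (by positivity : 0 ≤ 36 * K), h2.le]
  have hX' : K * (L : ℝ) ^ q * (β / 2) ^ (-θ) * (18 * (L : ℝ) ^ 4 - 2) ≤ 1 / 1024 := hX.trans hinvC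
  refine ⟨hβ0, by linarith only [hββ₀], fun x hx => ⟨?_, ?_⟩, ?_, ?_⟩
  · -- `L ≤ x^a` for `x ≥ β/2`
    have hx0 : 0 < x := lt_of_lt_of_le hh0 hx
    have h1 : (L : ℝ) ≤ β ^ (a / 2) := hLβ.trans (Real.rpow_le_rpow_of_exponent_le hβ1 ha'a)
    have h2 : β ^ (a / 2) ≤ (β / 2) ^ a := by
      -- `β^{a/2} ≤ (β/2)^a ⟸ β ≤ (β/2)^2` (as `β ≥ 4`)
      have h : β ≤ (β / 2) ^ (2 : ℝ) := by
        rw [show (2 : ℝ) = ((2 : ℕ) : ℝ) by norm_num, Real.rpow_natCast]; nlinarith only [hβ4]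
      calc β ^ (a / 2) ≤ ((β / 2) ^ (2 : ℝ)) ^ (a / 2) := Real.rpow_le_rpow hβ0.le h (by positivity)
        _ = (β / 2) ^ a := by rw [← Real.rpow_mul hh0.le]; ring_nf
    have h3 : (β / 2) ^ a ≤ x ^ a := Real.rpow_le_rpow hh0.le hx ha.le
    linarith only [h1, h2, h3]
  · -- `x^{−θ} ≤ (β/2)^{−θ}`
    exact Real.rpow_le_rpow_of_nonpos hh0 hx (by linarith only [hθ])
  · -- `K L^q (β/2)^{−θ} ≤ 18 L⁴ − 2`
    have h1 : K * (L : ℝ) ^ q * (β / 2) ^ (-θ) ≤ K * (L : ℝ) ^ q * (β / 2) ^ (-θ) * (18 * (L : ℝ) ^ 4 - 2) := by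
      have : (1 : ℝ) ≤ 18 * (L : ℝ) ^ 4 - 2 := by linarith only [hP1]
      exact le_mul_of_one_le_right (by positivity) this
    linarith only [h1, hX', hP1]
  · -- `8 √X ≤ 1/4`
    have h1 : Real.sqrt (K * (L : ℝ) ^ q * (β / 2) ^ (-θ) * (18 * (L : ℝ) ^ 4 - 2)) ≤ Real.sqrt (1 / 1024) := Real.sqrt_le_sqrt hX'
    have h2 : Real.sqrt (1 / 1024) = 1 / 32 := by
      rw [show (1 / 1024 : ℝ) = (1 / 32) ^ 2 by norm_num, Real.sqrt_sq (by norm_num)]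
    linarith only [h1, h2.le]

end Summit.QuantumFields.YangMills.Theorems.SwapVirialDeficitSwapGluedStiffnessWindow

end
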